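import Summits.AnomalousDissipation.AnomalousDissipation.Theorems.SawtoothPulseCascadeK1LocalisedCascadeLedgerThinTarget

/-!
# K1loc, line `Spectral` / thin start — helper: THE LEDGER CHAIN (telescoping bookkeeping + the free constant `c` + the closers)

Helper file of the prover lane on the crux `K1LocalisedCascade` (stmt-AnomalousDissipation-19491), route `SawtoothPulseCascade`
(S-B/S-C assembly seat).  The S-D target of record (`…LedgerThinTarget`): ANY `c > 0`, ONE `Q < ‖datum‖² = ½`, and for all large
`n` `LowBand_n(c) + HighOffCone_n(c) ≤ Q` for the explicit inviscid iterates `a_n`.  Both S-D designs on the table — the spectral FIBRE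
LEDGER (amplitudes `√E_{j+1} ≤ √E_j + η_j`, window lemma `K1Window.sum_window_sq_norm_comp_shearMap_le`, thresholds `K_{j+1} = g_jK_j`,
`g_j → γ²−2.3 > γ²−3`) and the threshold-averaged COMB LEDGER (energies `T̄_{j+1} ≤ T̄_j + ℓ_j`, certified start at a phase `j₀`) —
end in the same elementary assembly, typed here once, abstractly, with no definitions: §1 real-variable ledgers (telescoping in
amplitude / energy form, two half-steps combined, partial sums of non-negative summable junk under the shifted series, geometric tail);
§2 the FREE CONSTANT `c` (thresholds with `K_{j+1} ≥ g_jK_j`, `g_j ≥ r` from a phase `j₁` — or `g_j ≥ r(1−e_j)` with summable defects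
`e_j ≤ e* < 1` — admit `c > 0` with `(1+1/250)c rⁿ ≤ K_n`, `n ≥ j₁`); §3 channel domination (`LowBand_n(c) + HighOffCone_n(c) ≤
Σ'w(k)‖𝓕a_n(k)‖²` for ANY bounded weight `w` above the two indicators — the tracked pair `[|k₀| < K] + [K ≤ |k₀| ∧ a|k₀| < γ|k₁|]`,
`K ≥ (1+1/250)c rⁿ`, `a ≤ 13/10`; a symbol `μ̄_n ≥ μ_n²`; `1 − [released]`); §4 the closers `k1Localised_of_weight_ledger_frequently` /
`_of_amplitude_ledger` / `_of_energy_ledger` / `_of_threshold_ledger` (shape P: `N₀ = 1`, `ρN = 2`, `d = 2`, `5 ≤ γ ≤ 8`, `0 < δ₀ ≤ ¼`,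
`L_min ≥ 1000`): start bound at `j₀` + step from `j₀` + summable junk + budget `(√E_{j₀} + Σ'η)² < ‖datum‖²` (resp. `T_{j₀} + Σ'ℓ <
‖datum‖²`) ⇒ `K1Localised P (γ²−3)` via `k1Localised_of_thin_lowBand_offCone`.  Nothing here estimates a channel; nothing at `δ₀ = ¼`.
[cite: DEIJ2022, (1.2)–(1.3)] [cite: ElgindiLissMattingly2025, §1.2.2 and §3.1] [cite: Grafakos2014, Prop. 3.2.7 (3)] [problem: turb]
-/

-- `Summit.<Summit>.<Problem>`: single-conjunct summit, the duplicate namespace segment is deliberate.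
set_option linter.dupNamespace false

noncomputable section

namespace Summit.AnomalousDissipation.AnomalousDissipation.Theorems.SawtoothPulseCascade.K1Ledger.From

open MeasureTheory Set Filter Topology UnitAddTorus Function
open scoped ENNReal
open Literature.Analysis Literature.Analysis.FunctionSpaces Literature.Analysis.FunctionSpaces.Torus Literature.Analysis.FluidPDE
open Literature.Analysis.FluidPDE.ShearStage
open Literature.Analysis.FluidPDE.SawtoothCascade Literature.Analysis.FluidPDE.SawtoothCascade.CascadeParams
open Summit.AnomalousDissipation.AnomalousDissipation.Theorems.SawtoothPulseCascade.K1Symbol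
open Summit.AnomalousDissipation.AnomalousDissipation.Theorems.SawtoothPulseCascade.K1Start
open Summit.AnomalousDissipation.AnomalousDissipation.Theorems.SawtoothPulseCascade.K1Ledger

/-! ## §1 Real-variable ledgers -/

/-- **Amplitude ledger, telescoped**: if `√E_{j+1} ≤ √E_j + η_j` for all `j ≥ j₀` then
`√E_n ≤ √E_{j₀} + Σ_{j₀ ≤ j < n} η_j` for all `n ≥ j₀`. [folklore] -/
theorem sqrt_le_sqrt_add_sum_Ico {E η : ℕ → ℝ} {j₀ : ℕ}
    (hstep : ∀ j, j₀ ≤ j → Real.sqrt (E (j + 1)) ≤ Real.sqrt (E j) + η j) {n : ℕ} (hn : j₀ ≤ n) :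
    Real.sqrt (E n) ≤ Real.sqrt (E j₀) + ∑ j ∈ Finset.Ico j₀ n, η j := by
  induction n, hn using Nat.le_induction with
  | base => simp
  | succ n hn ih =>
    rw [Finset.sum_Ico_succ_top hn]
    linarith [hstep n hn]

/-- **Energy ledger, telescoped**: if `T_{j+1} ≤ T_j + ℓ_j` for all `j ≥ j₀` then `T_n ≤ T_{j₀} + Σ_{j₀ ≤ j < n} ℓ_j`
for all `n ≥ j₀`. [folklore] -/
theorem le_add_sum_Ico {T ℓ : ℕ → ℝ} {j₀ : ℕ} (hstep : ∀ j, j₀ ≤ j → T (j + 1) ≤ T j + ℓ j) {n : ℕ} (hn : j₀ ≤ n) :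
    T n ≤ T j₀ + ∑ j ∈ Finset.Ico j₀ n, ℓ j := by
  induction n, hn using Nat.le_induction with
  | base => simp
  | succ n hn ih =>
    rw [Finset.sum_Ico_succ_top hn]
    linarith [hstep n hn]

/-- **Two half-steps make one step** (amplitude form): `√y_j ≤ √x_j + ηᴴ_j` (first half-step, e.g. `a_j ↦ b_j`) and
`√x_{j+1} ≤ √y_j + ηⱽ_j` (second half-step, `b_j ↦ a_{j+1}`) give `√x_{j+1} ≤ √x_j + (ηᴴ_j + ηⱽ_j)`. [folklore] -/
theorem sqrt_step_of_half_steps {x y ηH ηV : ℕ → ℝ} {j₀ : ℕ}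
    (hH : ∀ j, j₀ ≤ j → Real.sqrt (y j) ≤ Real.sqrt (x j) + ηH j)
    (hV : ∀ j, j₀ ≤ j → Real.sqrt (x (j + 1)) ≤ Real.sqrt (y j) + ηV j) (j : ℕ) (hj : j₀ ≤ j) :
    Real.sqrt (x (j + 1)) ≤ Real.sqrt (x j) + (ηH j + ηV j) := by
  linarith [hH j hj, hV j hj]

/-- **A step inequality with an additive junk ENERGY gives one with an additive junk AMPLITUDE**:
from `E' ≤ E + ℓ` with `0 ≤ E`, `0 ≤ ℓ`: `√E' ≤ √E + √ℓ`. [folklore] -/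
theorem sqrt_le_sqrt_add_sqrt_of_le_add {E E' ℓ : ℝ} (hE : 0 ≤ E) (hℓ : 0 ≤ ℓ) (h : E' ≤ E + ℓ) :
    Real.sqrt E' ≤ Real.sqrt E + Real.sqrt ℓ := by
  have h0 : 0 ≤ Real.sqrt E + Real.sqrt ℓ := add_nonneg (Real.sqrt_nonneg _) (Real.sqrt_nonneg _)
  calc Real.sqrt E' ≤ Real.sqrt ((Real.sqrt E + Real.sqrt ℓ) ^ 2) :=
        Real.sqrt_le_sqrt (h.trans (by
          nlinarith [Real.sq_sqrt hE, Real.sq_sqrt hℓ, Real.sqrt_nonneg E, Real.sqrt_nonneg ℓ]))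
    _ = Real.sqrt E + Real.sqrt ℓ := Real.sqrt_sq h0

/-- **Partial sums of a non-negative summable sequence from `j₀` are bounded by the shifted series**:
`Σ_{j₀ ≤ j < n} η_j ≤ Σ'_i η_{j₀+i}`. [folklore] -/
theorem sum_Ico_le_tsum_shift {η : ℕ → ℝ} (hη0 : ∀ j, 0 ≤ η j) (hηs : Summable η) (j₀ n : ℕ) :
    ∑ j ∈ Finset.Ico j₀ n, η j ≤ ∑' i, η (j₀ + i) := by
  have hs : Summable fun i => η (j₀ + i) := hηs.comp_injective (add_right_injective j₀)
  rcases le_or_gt j₀ n with hn | hn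
  · rw [Finset.sum_Ico_eq_sum_range]
    exact hs.sum_le_tsum (Finset.range (n - j₀)) fun i _ => hη0 _
  · rw [Finset.Ico_eq_empty (by omega), Finset.sum_empty]
    exact tsum_nonneg fun i => hη0 _

/-- **Geometric junk**: for `0 ≤ A`, `0 ≤ θ < 1`, `Σ'_i A·θ^{j₀+i} = A·θ^{j₀}/(1 − θ)`. [folklore] -/
theorem tsum_geometric_shift {A θ : ℝ} (hθ0 : 0 ≤ θ) (hθ1 : θ < 1) (j₀ : ℕ) :
    ∑' i, A * θ ^ (j₀ + i) = A * θ ^ j₀ / (1 - θ) := by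
  have h : ∀ i, A * θ ^ (j₀ + i) = A * θ ^ j₀ * θ ^ i := fun i => by rw [pow_add, mul_assoc]
  simp_rw [h]
  rw [tsum_mul_left, tsum_geometric_of_lt_one hθ0 hθ1, div_eq_mul_inv]

/-! ## §2 The free constant `c`: thresholds growing at rate `≥ r` from some phase on -/

/-- **Thresholds growing at rate at least `r` dominate `c·rⁿ`**: if `0 ≤ K_{j₁}`, `K_{j+1} ≥ g_j·K_j` and `g_j ≥ r > 0`
for `j ≥ j₁`, then `(K_{j₁}/r^{j₁})·rⁿ ≤ K_n` for all `n ≥ j₁`. [folklore] -/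
theorem threshold_ge_of_growth {K g : ℕ → ℝ} {r : ℝ} (hr : 0 < r) {j₁ : ℕ} (hK₁ : 0 ≤ K j₁)
    (hK : ∀ j, j₁ ≤ j → g j * K j ≤ K (j + 1)) (hg : ∀ j, j₁ ≤ j → r ≤ g j) :
    ∀ n, j₁ ≤ n → K j₁ / r ^ j₁ * r ^ n ≤ K n := by
  intro n hn
  induction n, hn using Nat.le_induction with
  | base => rw [div_mul_cancel₀ _ (pow_ne_zero _ hr.ne')]
  | succ n hn ih =>
    have hKn : 0 ≤ K n := le_trans (by positivity) ih
    calc K j₁ / r ^ j₁ * r ^ (n + 1) = K j₁ / r ^ j₁ * r ^ n * r := by rw [pow_succ, mul_assoc]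
      _ ≤ K n * r := mul_le_mul_of_nonneg_right ih hr.le
      _ ≤ g n * K n := by rw [mul_comm]; exact mul_le_mul_of_nonneg_right (hg n hn) hKn
      _ ≤ K (n + 1) := hK n hn

/-- **The free constant from growth at rate `≥ r`**: under the hypotheses of `threshold_ge_of_growth` with `0 < K_{j₁}`
there is `c > 0` with `(1 + 1/250)·(c·rⁿ) ≤ K_n` for all `n ≥ j₁` (namely `c = K_{j₁}/((1+1/250) r^{j₁})`). [folklore] -/
theorem exists_thin_constant_of_growth {K g : ℕ → ℝ} {r : ℝ} (hr : 0 < r) {j₁ : ℕ} (hK₁ : 0 < K j₁)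
    (hK : ∀ j, j₁ ≤ j → g j * K j ≤ K (j + 1)) (hg : ∀ j, j₁ ≤ j → r ≤ g j) :
    ∃ c : ℝ, 0 < c ∧ ∀ n, j₁ ≤ n → (1 + 1 / 250) * (c * r ^ n) ≤ K n := by
  refine ⟨K j₁ / r ^ j₁ / (1 + 1 / 250), by positivity, fun n hn => ?_⟩
  have h := threshold_ge_of_growth hr hK₁.le hK hg n hn
  calc (1 + 1 / 250) * (K j₁ / r ^ j₁ / (1 + 1 / 250) * r ^ n) = K j₁ / r ^ j₁ * r ^ n := by
        field_simp
    _ ≤ K n := h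

/-- **One minus a small defect dominates an exponential**: for `0 ≤ e ≤ e* < 1`, `exp(−e/(1 − e*)) ≤ 1 − e`
(from `log x ≤ x − 1` at `x = 1/(1−e)`). [folklore] -/
theorem exp_neg_div_le_one_sub {e e₁ : ℝ} (he0 : 0 ≤ e) (he1 : e ≤ e₁) (he₁ : e₁ < 1) :
    Real.exp (-(e / (1 - e₁))) ≤ 1 - e := by
  have h1e : 0 < 1 - e := by linarith
  have h1e₁ : 0 < 1 - e₁ := by linarith
  -- `log (1 - e) ≥ -(e/(1-e)) ≥ -(e/(1-e₁))`
  have hlog : -(e / (1 - e)) ≤ Real.log (1 - e) := by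
    have h := Real.log_le_sub_one_of_pos (inv_pos.2 h1e)
    rw [Real.log_inv] at h
    have : (1 - e)⁻¹ - 1 = e / (1 - e) := by field_simp; ring
    linarith
  have hmono : e / (1 - e) ≤ e / (1 - e₁) := div_le_div_of_nonneg_left he0 h1e₁ (by linarith)
  calc Real.exp (-(e / (1 - e₁))) ≤ Real.exp (Real.log (1 - e)) := Real.exp_le_exp.2 (by linarith)
    _ = 1 - e := Real.exp_log h1e

/-- **Thresholds with summable growth defects dominate `c·rⁿ`**: if `0 < K_{j₁}`, `K_{j+1} ≥ r(1 − e_j)K_j` for `j ≥ j₁`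
with `0 ≤ e_j ≤ e* < 1` and `Σ e_j < ∞`, then `K_n ≥ (K_{j₁}/r^{j₁})·exp(−(Σ'_i e_{j₁+i})/(1−e*))·rⁿ` for all `n ≥ j₁`.
[folklore] -/
theorem threshold_ge_of_summable_defects {K e : ℕ → ℝ} {r e₁ : ℝ} (hr : 0 < r) {j₁ : ℕ} (hK₁ : 0 ≤ K j₁)
    (hK : ∀ j, j₁ ≤ j → r * (1 - e j) * K j ≤ K (j + 1)) (he0 : ∀ j, 0 ≤ e j) (he1 : ∀ j, j₁ ≤ j → e j ≤ e₁)
    (he₁ : e₁ < 1) (hes : Summable e) :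
    ∀ n, j₁ ≤ n → K j₁ / r ^ j₁ * Real.exp (-((∑' i, e (j₁ + i)) / (1 - e₁))) * r ^ n ≤ K n := by
  -- the sharper statement with the partial sum, by induction
  have hind : ∀ n, j₁ ≤ n →
      K j₁ / r ^ j₁ * Real.exp (-((∑ j ∈ Finset.Ico j₁ n, e j) / (1 - e₁))) * r ^ n ≤ K n := by
    intro n hn
    induction n, hn using Nat.le_induction with
    | base => simp [div_mul_cancel₀ _ (pow_ne_zero _ hr.ne')]
    | succ n hn ih =>
      have hKn : 0 ≤ K n := le_trans (by positivity) ih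
      have hstep : Real.exp (-(e n / (1 - e₁))) ≤ 1 - e n := exp_neg_div_le_one_sub (he0 n) (he1 n hn) he₁
      rw [Finset.sum_Ico_succ_top hn, add_div, neg_add, Real.exp_add, pow_succ]
      calc K j₁ / r ^ j₁ * (Real.exp (-((∑ j ∈ Finset.Ico j₁ n, e j) / (1 - e₁))) * Real.exp (-(e n / (1 - e₁)))) *
            (r ^ n * r)
          = (K j₁ / r ^ j₁ * Real.exp (-((∑ j ∈ Finset.Ico j₁ n, e j) / (1 - e₁))) * r ^ n) *
              (r * Real.exp (-(e n / (1 - e₁)))) := by ring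
        _ ≤ K n * (r * (1 - e n)) :=
            mul_le_mul ih (mul_le_mul_of_nonneg_left hstep hr.le) (by positivity) hKn
        _ = r * (1 - e n) * K n := by ring
        _ ≤ K (n + 1) := hK n hn
  intro n hn
  have h1e₁ : 0 < 1 - e₁ := by linarith
  have hsum : ∑ j ∈ Finset.Ico j₁ n, e j ≤ ∑' i, e (j₁ + i) := sum_Ico_le_tsum_shift he0 hes j₁ n
  have hexp : Real.exp (-((∑' i, e (j₁ + i)) / (1 - e₁))) ≤
      Real.exp (-((∑ j ∈ Finset.Ico j₁ n, e j) / (1 - e₁))) :=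
    Real.exp_le_exp.2 (neg_le_neg (div_le_div_of_nonneg_right hsum h1e₁.le))
  refine le_trans ?_ (hind n hn)
  have h0 : 0 ≤ K j₁ / r ^ j₁ := by positivity
  exact mul_le_mul_of_nonneg_right (mul_le_mul_of_nonneg_left hexp h0) (by positivity)

/-- **The free constant from summable growth defects**: under the hypotheses of `threshold_ge_of_summable_defects` with
`0 < K_{j₁}` there is `c > 0` with `(1 + 1/250)·(c·rⁿ) ≤ K_n` for all `n ≥ j₁`. [folklore] -/
theorem exists_thin_constant_of_summable_defects {K e : ℕ → ℝ} {r e₁ : ℝ} (hr : 0 < r) {j₁ : ℕ} (hK₁ : 0 < K j₁)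
    (hK : ∀ j, j₁ ≤ j → r * (1 - e j) * K j ≤ K (j + 1)) (he0 : ∀ j, 0 ≤ e j) (he1 : ∀ j, j₁ ≤ j → e j ≤ e₁)
    (he₁ : e₁ < 1) (hes : Summable e) :
    ∃ c : ℝ, 0 < c ∧ ∀ n, j₁ ≤ n → (1 + 1 / 250) * (c * r ^ n) ≤ K n := by
  refine ⟨K j₁ / r ^ j₁ * Real.exp (-((∑' i, e (j₁ + i)) / (1 - e₁))) / (1 + 1 / 250), by positivity, fun n hn => ?_⟩
  have h := threshold_ge_of_summable_defects hr hK₁.le hK he0 he1 he₁ hes n hn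
  calc (1 + 1 / 250) * (K j₁ / r ^ j₁ * Real.exp (-((∑' i, e (j₁ + i)) / (1 - e₁))) / (1 + 1 / 250) * r ^ n)
      = K j₁ / r ^ j₁ * Real.exp (-((∑' i, e (j₁ + i)) / (1 - e₁))) * r ^ n := by field_simp
    _ ≤ K n := h

/-! ## §3 Channel domination: the two channels under a tracked weight -/

/-- **Pointwise: the thin pair of indicators under the tracked pair at a larger threshold and a wider aperture.**
For `L' ≤ K` and `a ≤ 13/10`:
`[|k₀| < L'] + [L' ≤ |k₀| ∧ 13/10·|k₀| < γ|k₁|] ≤ [|k₀| < K] + [K ≤ |k₀| ∧ a·|k₀| < γ|k₁|]`. [folklore] -/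
theorem lowBand_add_offCone_indicator_le_tracked {γ L' K a : ℝ} (hK : L' ≤ K) (ha : a ≤ 13 / 10) (kh kv : ℤ) :
    (if |(kh : ℝ)| < L' then (1 : ℝ) else 0) +
        (if L' ≤ |(kh : ℝ)| ∧ 13 / 10 * |(kh : ℝ)| < γ * |(kv : ℝ)| then (1 : ℝ) else 0) ≤
      (if |(kh : ℝ)| < K then (1 : ℝ) else 0) +
        (if K ≤ |(kh : ℝ)| ∧ a * |(kh : ℝ)| < γ * |(kv : ℝ)| then (1 : ℝ) else 0) := by
  have hI : ∀ (p : Prop) [Decidable p], (0 : ℝ) ≤ (if p then (1 : ℝ) else 0) := fun p _ => by split_ifs <;> norm_num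
  have hI1 : ∀ (p : Prop) [Decidable p], (if p then (1 : ℝ) else 0) ≤ 1 := fun p _ => by split_ifs <;> norm_num
  have h0 : 0 ≤ |(kh : ℝ)| := abs_nonneg _
  by_cases hA : |(kh : ℝ)| < L'
  · rw [if_pos hA, if_pos (lt_of_lt_of_le hA hK), if_neg (fun h => (not_le.2 hA) h.1), add_zero]
    linarith [hI (K ≤ |(kh : ℝ)| ∧ a * |(kh : ℝ)| < γ * |(kv : ℝ)|)]
  · rw [if_neg hA, zero_add]
    by_cases hB : |(kh : ℝ)| < K
    · rw [if_pos hB]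
      linarith [hI1 (L' ≤ |(kh : ℝ)| ∧ 13 / 10 * |(kh : ℝ)| < γ * |(kv : ℝ)|),
        hI (K ≤ |(kh : ℝ)| ∧ a * |(kh : ℝ)| < γ * |(kv : ℝ)|)]
    · rw [if_neg hB, zero_add]
      by_cases hC : 13 / 10 * |(kh : ℝ)| < γ * |(kv : ℝ)|
      · have hC' : a * |(kh : ℝ)| < γ * |(kv : ℝ)| :=
          lt_of_le_of_lt (mul_le_mul_of_nonneg_right ha h0) hC
        rw [if_pos ⟨le_of_not_gt hA, hC⟩, if_pos ⟨le_of_not_gt hB, hC'⟩]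
      · rw [if_neg (fun h => hC h.2)]
        exact hI _

/-- **The tracked pair is the indicator of the union** `{|k₀| < K} ∪ {a·|k₀| < γ|k₁|}`:
`[|k₀| < K] + [K ≤ |k₀| ∧ a|k₀| < γ|k₁|] = [|k₀| < K ∨ a|k₀| < γ|k₁|]`. [folklore] -/
theorem tracked_pair_eq_union_indicator (γ K a : ℝ) (kh kv : ℤ) :
    (if |(kh : ℝ)| < K then (1 : ℝ) else 0) +
        (if K ≤ |(kh : ℝ)| ∧ a * |(kh : ℝ)| < γ * |(kv : ℝ)| then (1 : ℝ) else 0) =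
      (if |(kh : ℝ)| < K ∨ a * |(kh : ℝ)| < γ * |(kv : ℝ)| then (1 : ℝ) else 0) := by
  by_cases hA : |(kh : ℝ)| < K
  · rw [if_pos hA, if_neg (fun h => (not_le.2 hA) h.1), if_pos (Or.inl hA), add_zero]
  · rw [if_neg hA, zero_add]
    by_cases hC : a * |(kh : ℝ)| < γ * |(kv : ℝ)|
    · rw [if_pos ⟨le_of_not_gt hA, hC⟩, if_pos (Or.inr hC)]
    · rw [if_neg (fun h => hC h.2), if_neg (fun h => h.elim hA hC)]

/-- **Weighted Fourier sums of a continuous scalar with a bounded non-negative weight are summable** (Parseval). [folklore] -/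
theorem summable_weight_mul_sq_norm {θ : UnitAddTorus (Fin 2) → ℝ} (hθ : Continuous θ) {w : (Fin 2 → ℤ) → ℝ} {B : ℝ}
    (hw0 : ∀ k, 0 ≤ w k) (hwB : ∀ k, w k ≤ B) :
    Summable fun k : Fin 2 → ℤ => w k * ‖mFourierCoeff (fun x => (θ x : ℂ)) k‖ ^ 2 := by
  have hP := (SpectralLeakage.hasSum_sq_norm_mFourierCoeff_scalarL2Sq hθ).summable
  refine Summable.of_nonneg_of_le (fun k => mul_nonneg (hw0 k) (sq_nonneg _))
    (fun k => mul_le_mul_of_nonneg_right (hwB k) (sq_nonneg _)) (hP.mul_left B)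

/-- **Channel domination**: if a bounded weight `w` dominates the two thin indicators pointwise,
`[|k₀| < L'] + [L' ≤ |k₀| ∧ 13/10·|k₀| < γ|k₁|] ≤ w(k)`, then
`LowBand + HighOffCone = Σ'[|k₀| < L']‖𝓕θ‖² + Σ'[L' ≤ |k₀| ∧ 13/10|k₀| < γ|k₁|]‖𝓕θ‖² ≤ Σ' w(k)‖𝓕θ(k)‖²`
for every continuous real scalar `θ` on `𝕋²`. [cite: Grafakos2014, Prop. 3.2.7 (3)] -/
theorem lowBand_add_highOffCone_le_weight {θ : UnitAddTorus (Fin 2) → ℝ} (hθ : Continuous θ) {γ L' B : ℝ}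
    {w : (Fin 2 → ℤ) → ℝ} (hwB : ∀ k, w k ≤ B)
    (hw : ∀ k : Fin 2 → ℤ, (if |((k 0 : ℤ) : ℝ)| < L' then (1 : ℝ) else 0) +
        (if L' ≤ |((k 0 : ℤ) : ℝ)| ∧ 13 / 10 * |((k 0 : ℤ) : ℝ)| < γ * |((k 1 : ℤ) : ℝ)| then (1 : ℝ) else 0) ≤ w k) :
    ∑' k : Fin 2 → ℤ, (if |((k 0 : ℤ) : ℝ)| < L' then (1 : ℝ) else 0) * ‖mFourierCoeff (fun x => (θ x : ℂ)) k‖ ^ 2 +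
        ∑' k : Fin 2 → ℤ, (if L' ≤ |((k 0 : ℤ) : ℝ)| ∧ 13 / 10 * |((k 0 : ℤ) : ℝ)| < γ * |((k 1 : ℤ) : ℝ)|
            then (1 : ℝ) else 0) * ‖mFourierCoeff (fun x => (θ x : ℂ)) k‖ ^ 2 ≤
      ∑' k : Fin 2 → ℤ, w k * ‖mFourierCoeff (fun x => (θ x : ℂ)) k‖ ^ 2 := by
  have hI : ∀ (p : Prop) [Decidable p], (0 : ℝ) ≤ (if p then (1 : ℝ) else 0) := fun p _ => by split_ifs <;> norm_num
  have hI1 : ∀ (p : Prop) [Decidable p], (if p then (1 : ℝ) else 0) ≤ 1 := fun p _ => by split_ifs <;> norm_num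
  have hw0 : ∀ k, 0 ≤ w k := fun k => le_trans (add_nonneg (hI _) (hI _)) (hw k)
  have hsI : ∀ (p : (Fin 2 → ℤ) → Prop) [DecidablePred p],
      Summable fun k => (if p k then (1 : ℝ) else 0) * ‖mFourierCoeff (fun x => (θ x : ℂ)) k‖ ^ 2 :=
    fun p _ => summable_weight_mul_sq_norm hθ (fun k => hI _) (fun k => hI1 _)
  have h1 := hsI (fun k => |((k 0 : ℤ) : ℝ)| < L')
  have h2 := hsI (fun k => L' ≤ |((k 0 : ℤ) : ℝ)| ∧ 13 / 10 * |((k 0 : ℤ) : ℝ)| < γ * |((k 1 : ℤ) : ℝ)|)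
  rw [← h1.tsum_add h2]
  refine Summable.tsum_le_tsum (fun k => ?_) (h1.add h2) (summable_weight_mul_sq_norm hθ hw0 hwB)
  rw [← add_mul]
  exact mul_le_mul_of_nonneg_right (hw k) (sq_nonneg _)

/-- **Channel domination by the tracked pair**: for `(1+1/250)·L ≤ K` and `a ≤ 13/10`,
`LowBand(L) + HighOffCone(L) ≤ Σ'([|k₀| < K] + [K ≤ |k₀| ∧ a|k₀| < γ|k₁|])‖𝓕θ‖²` — the energy of `θ` in the strip of
half-width `K` plus its energy in the high off-cone of aperture `a`. [cite: Grafakos2014, Prop. 3.2.7 (3)] -/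
theorem lowBand_add_highOffCone_le_tracked {θ : UnitAddTorus (Fin 2) → ℝ} (hθ : Continuous θ) {γ L K a : ℝ}
    (hK : (1 + 1 / 250) * L ≤ K) (ha : a ≤ 13 / 10) :
    ∑' k : Fin 2 → ℤ, (if |((k 0 : ℤ) : ℝ)| < (1 + 1 / 250) * L then (1 : ℝ) else 0) *
          ‖mFourierCoeff (fun x => (θ x : ℂ)) k‖ ^ 2 +
        ∑' k : Fin 2 → ℤ, (if (1 + 1 / 250) * L ≤ |((k 0 : ℤ) : ℝ)| ∧
            13 / 10 * |((k 0 : ℤ) : ℝ)| < γ * |((k 1 : ℤ) : ℝ)| then (1 : ℝ) else 0) * ‖mFourierCoeff (fun x => (θ x : ℂ)) k‖ ^ 2 ≤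
      ∑' k : Fin 2 → ℤ, ((if |((k 0 : ℤ) : ℝ)| < K then (1 : ℝ) else 0) +
          (if K ≤ |((k 0 : ℤ) : ℝ)| ∧ a * |((k 0 : ℤ) : ℝ)| < γ * |((k 1 : ℤ) : ℝ)| then (1 : ℝ) else 0)) *
        ‖mFourierCoeff (fun x => (θ x : ℂ)) k‖ ^ 2 := by
  have hI1 : ∀ (p : Prop) [Decidable p], (if p then (1 : ℝ) else 0) ≤ 1 := fun p _ => by split_ifs <;> norm_num
  exact lowBand_add_highOffCone_le_weight hθ (B := 1 + 1) (fun k => add_le_add (hI1 _) (hI1 _))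
    (fun k => lowBand_add_offCone_indicator_le_tracked hK ha (k 0) (k 1))

section Cascade

variable (P : CascadeParams)

/-! ## §4 The closers -/

/-- **`K1Localised P (γ² − 3)` from a WEIGHT LEDGER, frequently in `n`** (shape P, `L_min ≥ 1000`): ANY `c > 0`, ONE
`Q < ‖datum‖²`, a bounded family of weights `w_n` and infinitely many `n` at which `w_n` dominates the two thin indicators at
level `L' = (1+1/250)c(γ²−3)ⁿ` pointwise AND `Σ' w_n(k)‖𝓕a_n(k)‖² ≤ Q`.  (Tracked indicator pair of a fibre ledger;
threshold-averaged symbol `μ̄_n ≥ μ_n² ≥ …`; `1 − [released]`.)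
[cite: DEIJ2022, (1.2)–(1.3)] [cite: ElgindiLissMattingly2025, §1.2.2 and §3.1] [cite: Grafakos2014, Prop. 3.2.7 (3)] -/
theorem k1Localised_of_weight_ledger_frequently (hγ : 5 ≤ P.γ) (hγ' : P.γ ≤ 8) (hδ₀ : 0 < P.δ₀)
    (hδ₀' : P.δ₀ ≤ 1 / 4) (hd : P.d = 2) (hN₀ : P.N₀ = 1) (hρN : P.ρN = 2) {Lm : ℝ} (hLm : 1000 ≤ Lm)
    (a b : ℕ → UnitAddTorus (Fin 2) → ℝ) (has : ∀ j, IsSmooth (a j)) (h0 : a 0 = datum)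
    (hb : ∀ j, b j = a j ∘ shearMap 0 1 (amp ⟨P.U j, P.U_periodic j, P.contDiff_U (P.δ_pos hδ₀ (by rw [hd]; norm_num) j)⟩ P.γ))
    (hab : ∀ j, a (j + 1) = b j ∘ shearMap 1 0 (amp ⟨P.U j, P.U_periodic j, P.contDiff_U (P.δ_pos hδ₀ (by rw [hd]; norm_num) j)⟩ P.γ))
    {c : ℝ} (hc : 0 < c) {Q : ℝ} (hQ : Q < Torus.scalarL2Sq datum) (w : ℕ → (Fin 2 → ℤ) → ℝ) {B : ℝ}
    (hwB : ∀ n k, w n k ≤ B)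
    (hw : ∃ᶠ n : ℕ in atTop,
      (∀ k : Fin 2 → ℤ, (if |((k 0 : ℤ) : ℝ)| < (1 + 1 / 250) * (c * (P.γ ^ 2 - 3) ^ n) then (1 : ℝ) else 0) +
          (if (1 + 1 / 250) * (c * (P.γ ^ 2 - 3) ^ n) ≤ |((k 0 : ℤ) : ℝ)| ∧
            13 / 10 * |((k 0 : ℤ) : ℝ)| < P.γ * |((k 1 : ℤ) : ℝ)| then (1 : ℝ) else 0) ≤ w n k) ∧
        ∑' k : Fin 2 → ℤ, w n k * ‖mFourierCoeff (fun x => (a n x : ℂ)) k‖ ^ 2 ≤ Q) :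
    K1Localised P (P.γ ^ 2 - 3) :=
  k1Localised_of_thin_lowBand_offCone_frequently P hγ hγ' hδ₀ hδ₀' hd hN₀ hρN hLm a b has h0 hb hab hc hQ
    (hw.mono fun n hn => (lowBand_add_highOffCone_le_weight (has n).continuous (hwB n) hn.1).trans hn.2)

/-- **`K1Localised P (γ² − 3)` from an AMPLITUDE LEDGER** (the bookkeeping of a spectral fibre ledger; shape P,
`L_min ≥ 1000`).  Data: ANY `c > 0`; real sequences `E` (tracked energies) and `η ≥ 0` (junk amplitudes) with
* domination `LowBand_n(c) + HighOffCone_n(c) ≤ E_n` for `n ≥ i₁` (e.g. by `lowBand_add_highOffCone_le_tracked`),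
* the step `√E_{j+1} ≤ √E_j + η_j` for `j ≥ j₀` (e.g. two half-steps of `K1Window.sqrt_sum_window_sq_norm_comp_shearMap_le`
  plus truncation tails, combined by `sqrt_step_of_half_steps`),
* summable junk and the budget `(√E_{j₀} + Σ'_i η_{j₀+i})² < ‖datum‖² (= ½)`.
Then `K1Localised P (γ² − 3)`. [cite: DEIJ2022, (1.2)–(1.3)] [cite: ElgindiLissMattingly2025, §1.2.2 and §3.1] -/
theorem k1Localised_of_amplitude_ledger (hγ : 5 ≤ P.γ) (hγ' : P.γ ≤ 8) (hδ₀ : 0 < P.δ₀)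
    (hδ₀' : P.δ₀ ≤ 1 / 4) (hd : P.d = 2) (hN₀ : P.N₀ = 1) (hρN : P.ρN = 2) {Lm : ℝ} (hLm : 1000 ≤ Lm)
    (a b : ℕ → UnitAddTorus (Fin 2) → ℝ) (has : ∀ j, IsSmooth (a j)) (h0 : a 0 = datum)
    (hb : ∀ j, b j = a j ∘ shearMap 0 1 (amp ⟨P.U j, P.U_periodic j, P.contDiff_U (P.δ_pos hδ₀ (by rw [hd]; norm_num) j)⟩ P.γ))
    (hab : ∀ j, a (j + 1) = b j ∘ shearMap 1 0 (amp ⟨P.U j, P.U_periodic j, P.contDiff_U (P.δ_pos hδ₀ (by rw [hd]; norm_num) j)⟩ P.γ))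
    {c : ℝ} (hc : 0 < c) (E η : ℕ → ℝ) {i₁ j₀ : ℕ}
    (hdom : ∀ n : ℕ, i₁ ≤ n →
      ∑' k : Fin 2 → ℤ, (if |((k 0 : ℤ) : ℝ)| < (1 + 1 / 250) * (c * (P.γ ^ 2 - 3) ^ n) then (1 : ℝ) else 0) *
          ‖mFourierCoeff (fun x => (a n x : ℂ)) k‖ ^ 2 +
        ∑' k : Fin 2 → ℤ, (if (1 + 1 / 250) * (c * (P.γ ^ 2 - 3) ^ n) ≤ |((k 0 : ℤ) : ℝ)| ∧
            13 / 10 * |((k 0 : ℤ) : ℝ)| < P.γ * |((k 1 : ℤ) : ℝ)| then (1 : ℝ) else 0) *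
          ‖mFourierCoeff (fun x => (a n x : ℂ)) k‖ ^ 2 ≤ E n)
    (hstep : ∀ j, j₀ ≤ j → Real.sqrt (E (j + 1)) ≤ Real.sqrt (E j) + η j) (hη0 : ∀ j, 0 ≤ η j) (hηs : Summable η)
    (hbudget : (Real.sqrt (E j₀) + ∑' i, η (j₀ + i)) ^ 2 < Torus.scalarL2Sq datum) :
    K1Localised P (P.γ ^ 2 - 3) := by
  refine k1Localised_of_thin_lowBand_offCone P hγ hγ' hδ₀ hδ₀' hd hN₀ hρN hLm a b has h0 hb hab hc hbudget
    (i₁ := max i₁ j₀) fun n hn => (hdom n (le_of_max_le_left hn)).trans ?_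
  -- `E n ≤ (√E_{j₀} + Σ_{Ico})² ≤ (√E_{j₀} + Σ')²`
  have hS0 : 0 ≤ ∑ j ∈ Finset.Ico j₀ n, η j := Finset.sum_nonneg fun j _ => hη0 j
  have hamp : Real.sqrt (E n) ≤ Real.sqrt (E j₀) + ∑ j ∈ Finset.Ico j₀ n, η j :=
    sqrt_le_sqrt_add_sum_Ico hstep (le_of_max_le_right hn)
  have htail : ∑ j ∈ Finset.Ico j₀ n, η j ≤ ∑' i, η (j₀ + i) := sum_Ico_le_tsum_shift hη0 hηs j₀ n
  rcases le_or_gt 0 (E n) with hEn | hEn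
  · calc E n = Real.sqrt (E n) ^ 2 := (Real.sq_sqrt hEn).symm
      _ ≤ (Real.sqrt (E j₀) + ∑ j ∈ Finset.Ico j₀ n, η j) ^ 2 :=
          pow_le_pow_left₀ (Real.sqrt_nonneg _) hamp 2
      _ ≤ (Real.sqrt (E j₀) + ∑' i, η (j₀ + i)) ^ 2 :=
          pow_le_pow_left₀ (add_nonneg (Real.sqrt_nonneg _) hS0) (by linarith) 2
  · exact hEn.le.trans (sq_nonneg _)

/-- **`K1Localised P (γ² − 3)` from an ENERGY LEDGER** (the bookkeeping of the threshold-averaged comb ledger; shape P,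
`L_min ≥ 1000`).  Data: ANY `c > 0`; real sequences `T` (tracked energies, e.g. `T̄_n = Σ' μ̄_n‖𝓕a_n‖²`) and `ℓ ≥ 0` with
domination `LowBand_n(c) + HighOffCone_n(c) ≤ T_n` for `n ≥ i₁` (e.g. by `lowBand_add_highOffCone_le_weight`), the step
`T_{j+1} ≤ T_j + ℓ_j` for `j ≥ j₀`, summable junk and the budget `T_{j₀} + Σ'_i ℓ_{j₀+i} < ‖datum‖²`.  Then
`K1Localised P (γ² − 3)`. [cite: DEIJ2022, (1.2)–(1.3)] [cite: ElgindiLissMattingly2025, §1.2.2 and §3.1] -/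
theorem k1Localised_of_energy_ledger (hγ : 5 ≤ P.γ) (hγ' : P.γ ≤ 8) (hδ₀ : 0 < P.δ₀)
    (hδ₀' : P.δ₀ ≤ 1 / 4) (hd : P.d = 2) (hN₀ : P.N₀ = 1) (hρN : P.ρN = 2) {Lm : ℝ} (hLm : 1000 ≤ Lm)
    (a b : ℕ → UnitAddTorus (Fin 2) → ℝ) (has : ∀ j, IsSmooth (a j)) (h0 : a 0 = datum)
    (hb : ∀ j, b j = a j ∘ shearMap 0 1 (amp ⟨P.U j, P.U_periodic j, P.contDiff_U (P.δ_pos hδ₀ (by rw [hd]; norm_num) j)⟩ P.γ))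
    (hab : ∀ j, a (j + 1) = b j ∘ shearMap 1 0 (amp ⟨P.U j, P.U_periodic j, P.contDiff_U (P.δ_pos hδ₀ (by rw [hd]; norm_num) j)⟩ P.γ))
    {c : ℝ} (hc : 0 < c) (T ℓ : ℕ → ℝ) {i₁ j₀ : ℕ}
    (hdom : ∀ n : ℕ, i₁ ≤ n →
      ∑' k : Fin 2 → ℤ, (if |((k 0 : ℤ) : ℝ)| < (1 + 1 / 250) * (c * (P.γ ^ 2 - 3) ^ n) then (1 : ℝ) else 0) *
          ‖mFourierCoeff (fun x => (a n x : ℂ)) k‖ ^ 2 +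
        ∑' k : Fin 2 → ℤ, (if (1 + 1 / 250) * (c * (P.γ ^ 2 - 3) ^ n) ≤ |((k 0 : ℤ) : ℝ)| ∧
            13 / 10 * |((k 0 : ℤ) : ℝ)| < P.γ * |((k 1 : ℤ) : ℝ)| then (1 : ℝ) else 0) *
          ‖mFourierCoeff (fun x => (a n x : ℂ)) k‖ ^ 2 ≤ T n)
    (hstep : ∀ j, j₀ ≤ j → T (j + 1) ≤ T j + ℓ j) (hℓ0 : ∀ j, 0 ≤ ℓ j) (hℓs : Summable ℓ)
    (hbudget : T j₀ + ∑' i, ℓ (j₀ + i) < Torus.scalarL2Sq datum) :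
    K1Localised P (P.γ ^ 2 - 3) := by
  refine k1Localised_of_thin_lowBand_offCone P hγ hγ' hδ₀ hδ₀' hd hN₀ hρN hLm a b has h0 hb hab hc hbudget
    (i₁ := max i₁ j₀) fun n hn => (hdom n (le_of_max_le_left hn)).trans ?_
  have h1 : T n ≤ T j₀ + ∑ j ∈ Finset.Ico j₀ n, ℓ j := le_add_sum_Ico hstep (le_of_max_le_right hn)
  have h2 : ∑ j ∈ Finset.Ico j₀ n, ℓ j ≤ ∑' i, ℓ (j₀ + i) := sum_Ico_le_tsum_shift hℓ0 hℓs j₀ n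
  linarith

/-- **`K1Localised P (γ² − 3)` from a THRESHOLD LEDGER** (the fibre ledger in the form of memo v9 §4: tracked energies
`E_n = Σ'([|k₀| < K_n] + [K_n ≤ |k₀| ∧ a_n|k₀| < γ|k₁|])‖𝓕a_n‖²` at thresholds `K_n` growing at rate `≥ γ² − 3` from a phase `j₁`
on — the free constant is `c = K_{j₁}/((1+1/250)(γ²−3)^{j₁})` — and apertures `a_n ≤ 13/10`; the amplitude step from `j₀`,
summable junk, budget `(√E_{j₀} + Σ'_i η_{j₀+i})² < ‖datum‖²`).
[cite: DEIJ2022, (1.2)–(1.3)] [cite: ElgindiLissMattingly2025, §1.2.2 and §3.1] [cite: Grafakos2014, Prop. 3.2.7 (3)] -/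
theorem k1Localised_of_threshold_ledger (hγ : 5 ≤ P.γ) (hγ' : P.γ ≤ 8) (hδ₀ : 0 < P.δ₀)
    (hδ₀' : P.δ₀ ≤ 1 / 4) (hd : P.d = 2) (hN₀ : P.N₀ = 1) (hρN : P.ρN = 2) {Lm : ℝ} (hLm : 1000 ≤ Lm)
    (a b : ℕ → UnitAddTorus (Fin 2) → ℝ) (has : ∀ j, IsSmooth (a j)) (h0 : a 0 = datum)
    (hb : ∀ j, b j = a j ∘ shearMap 0 1 (amp ⟨P.U j, P.U_periodic j, P.contDiff_U (P.δ_pos hδ₀ (by rw [hd]; norm_num) j)⟩ P.γ))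
    (hab : ∀ j, a (j + 1) = b j ∘ shearMap 1 0 (amp ⟨P.U j, P.U_periodic j, P.contDiff_U (P.δ_pos hδ₀ (by rw [hd]; norm_num) j)⟩ P.γ))
    (K g ap E η : ℕ → ℝ) {j₁ j₀ : ℕ} (hK₁ : 0 < K j₁) (hK : ∀ j, j₁ ≤ j → g j * K j ≤ K (j + 1))
    (hg : ∀ j, j₁ ≤ j → P.γ ^ 2 - 3 ≤ g j) (hap : ∀ n, ap n ≤ 13 / 10)
    (hE : ∀ n, j₁ ≤ n → ∑' k : Fin 2 → ℤ, ((if |((k 0 : ℤ) : ℝ)| < K n then (1 : ℝ) else 0) +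
        (if K n ≤ |((k 0 : ℤ) : ℝ)| ∧ ap n * |((k 0 : ℤ) : ℝ)| < P.γ * |((k 1 : ℤ) : ℝ)| then (1 : ℝ) else 0)) *
      ‖mFourierCoeff (fun x => (a n x : ℂ)) k‖ ^ 2 ≤ E n)
    (hstep : ∀ j, j₀ ≤ j → Real.sqrt (E (j + 1)) ≤ Real.sqrt (E j) + η j) (hη0 : ∀ j, 0 ≤ η j) (hηs : Summable η)
    (hbudget : (Real.sqrt (E j₀) + ∑' i, η (j₀ + i)) ^ 2 < Torus.scalarL2Sq datum) :
    K1Localised P (P.γ ^ 2 - 3) := by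
  have hr0 : 0 < P.γ ^ 2 - 3 := by nlinarith
  obtain ⟨c, hc, hcK⟩ := exists_thin_constant_of_growth hr0 hK₁ hK hg
  exact k1Localised_of_amplitude_ledger P hγ hγ' hδ₀ hδ₀' hd hN₀ hρN hLm a b has h0 hb hab hc E η (i₁ := j₁)
    (fun n hn => (lowBand_add_highOffCone_le_tracked (has n).continuous (hcK n hn) (hap n)).trans (hE n hn))
    hstep hη0 hηs hbudget

end Cascade

end Summit.AnomalousDissipation.AnomalousDissipation.Theorems.SawtoothPulseCascade.K1Ledger.From
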